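import HarnessLib
import Summits.ResolutionOfSingularities.Statement
import Literature.AlgebraicGeometry.Resolution.BlowupSequencesExtensions
import Summits.ResolutionOfSingularities.ResolutionOfSingularities.Theorems.ForcedTowerClasses
import Summits.ResolutionOfSingularities.ResolutionOfSingularities.Theorems.DivergentTowerClasses
import Summits.ResolutionOfSingularities.ResolutionOfSingularities.Theorems.MonomialTowerClasses

/-!
# HugDimensionClasses — vocabulary, pieces, ports and paper proofs of the node «HugDimension»
(decomp-res node N54, lens-4 g10 rev 2, source sha256 ee3232b051ee315d; CRITIC-LEDGER row 64 CLEARED; route-independent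
part, phase 1a of 3 — the proved kernels are `Theorems/HugDimensionKernels`, the edges to the route asides of
`Theses/MaxContactCut` BY NAME are `Theorems/MaxContactCutHugDimension`.  Text below = the lens file's own summary and
PAPER PROOFS (ports are HYPOTHESES of kernels, counted 0; the proofs are the blueprint for the port provers).)

BLOCKER FIRST.  Target BY NAME: the MaxContactCut aside `NoHuggingTowers` (stmt-31570: `∀ n ≥ 1,
MonomialTowerClasses.HuggingTowersTerminate n` — no infinite FORCED point tower of the class (point blow-ups at ISOLATED
points of the top locus, boundary-free root, dim ≤ 4, any prime characteristic) HUGS SOME GERM forever), THE LOCATED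
RESIDUAL of the tower side after generation 9.  Generation 9 (MonomialTowers, CRITIC-LEDGER row 58 CLEARED) is LANDED:
`Theorems.MonomialTowerClasses` (corner towers `CornerTower d n`, the critic's collapse `CornerTower.not_exhaustive`
PROVED, ports `CornerNormalForm` / `CornerNormalFormPlus` / `CornerModel`, pieces `TransversalTowersTerminate` /
`HuggingTowersTerminate` / `ContactHuggingTowersTerminate` / `WildHuggingTowersTerminate`) and the asides
`NoTransversalTowers` 31569 [DECIDED-MOD-PORT by `CornerNormalFormAll` 31573 ALONE], `NoHuggingTowers` 31570 [residual,
≡ `NoForcedTowers` 30253 modulo the decided piece], `NoContactHuggingTowers` 31571 / `NoWildHuggingTowers` 31572 [its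
two leaves].  30253 gives `E 1` / `RungOne` (29273) / `StepPICoreDimFour` (28544) through the LANDED kernels
`MaxContactCutForcedTowers.e_one_of_forced / core_of_forced`; g8 is LANDED as `Theorems.DivergentTowerClasses` + asides
31258–31262 (`NoCoreValuativeTowers` 31261, `NoCoreGermHuggingTowers` 31260).

THIS NODE (all statements over the TREE's `ForcedTower`, `HugsGerm`, `GermHugging`, `ContactHugging`, `Hugs`, `NoTower`,
`CornerTower`, `NoCornerTower`, `CornerNormalFormPlus`, `CornerModel`; no tree declaration re-typed):

* (A) ONE MORE EDGE BY NAME from the booked collapse: the tree's port aside `CornerNormalFormAll` (31573) ALONE gives the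
  TREE ITEM 31261 `MaxContactCut.NoCoreValuativeTowers` (`noCoreValuativeTowers_of_cornerNormalFormAll`) and g8's
  valuative leaf for EVERY `k` (`valuativeAll_of_cornerNormalFormAll`) — the erratum of rows 52/58 typed as a kernel
  between two tree items.
* (B) THE RE-CUT (critic's offer row 58, adopted): the intrinsic predicate `EventuallyMonomial T` (the stalk of the
  controlled transform at `pt i` is generated by monomials in the stalks of the boundary components, `i ≫ 0`; no chart,
  no hugging hypothesis).  EXACT: `ForcedTowersTerminate n ⟺ MonomialTowersTerminate n ∧ NonMonomialTowersTerminate n`;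
  the monomial class is DECIDED-MOD-PORT(KNOWN) (`monomial_of_ports`: port `MonomialCorner` = (e)(f) of g9 WITHOUT the
  hugging hypothesis + the tree's combinatorial leaf `NoCornerTower d n, d ≤ 4`, KNOWN via the tree's `CornerModel` +
  `TowerObstructs` (`MonomialTowerClasses.noCornerTower_of_model`; [Blanco arXiv:0902.2887 p.5, Rem. 1.23, p.12]),
  ATTACKABLE directly (#17′, `d ≤ 1` in the tree)) and contains, besides every transversal tower
  (`noTransversalTowers_of_monomial`), every BOUNDARY-HUGGING monomial tower — the «one chart slot never played»
  sub-class the critic placed inside `NoContactHuggingTowers` 31571 is thereby PEELED OFF the residual as decided.  The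
  located residual is `NoNonMonomialTowers`, with `NoNonMonomialTowers ⟸ NoHuggingTowers` modulo `TransversalMonomial`
  (port (c)(d): a hug-nothing tower is eventually monomial) and `NoHuggingTowers ⟸ NoNonMonomialTowers` modulo
  `MonomialCorner` + the leaf: THE ONE EQUIV `noHuggingTowers_iff_nonMonomial` (31570 ⟺ residual, modulo decided
  pieces; `noForcedTowers_iff_nonMonomial` is the same layer one item up).  STRUCTURE port `GeneratorHugging`
  (contrapositive of (c)(d) at every stage): a never-monomial tower hugs, from EVERY stage `m`, a PRIME DIVISOR `V(g)`,
  `g` a prime factor of a member of `I_m` of order `n` — hugged germs of generator size.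
* (C) THE g10 EXTREMAL MOVES (new; take the hugged germ of MINIMAL DIMENSION `w`):
  (C1) CURVE LAW (port `CurveLaw`, classical/elementary, ALL `k`, all `p`, all `d`; paper proof below): no forced tower
       hugs a germ of dimension `1` — along a hugged regular curve the transversal order `ν < n` is constant and the
       `t`-adic order `μ_j ≥ n − ν ≥ 1` of the degree-`ν` coefficients DROPS by `n − ν` at every step.
Typed so that
       Lean does the descent: the port delivers `(δ ≥ 1, μ : ℕ → ℕ)` with `δ ≤ μ j` and `μ (j+1) + δ
≤ μ j`; kernel
       `noInfiniteDescent` (PROVED) closes `CurveHuggingTowersTerminate n` (`curve_of_curveLaw`).  So `w ≥ 2`.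
  (C2) ETERNAL BOUND (port `EternalBound` ⟸ snc + (C1)): at most `d − 2 ≤ 2` of the tower's own exceptional
       components are hugged forever (`d − 1` eternal components through `pt i` cut out a hugged REGULAR CURVE); every
       other own component is eventually exited for good (EXIT LAW).  Kernel `noThreeEternal`.
  (C3) THE LOCATED CUT OF THE RESIDUAL BY `w` (EXACT, `nonMonomial_iff_leaves`):
       `NonMonomial ⟺ (∧ CurveHugging) [EMPTY by (C1)] ∧ SurfaceHuggingTowersTerminate [w = 2] ∧
        HypersurfaceHuggingTowersTerminate [w = 3: only hypersurface germs hugged]`, both leaves UNDECIDED (score 0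
       honestly), with the port-level structure recorded below: w = 2 ⇒ the shadow point sequence on the hugged surface
       hugs no curve, so it is the centre sequence of a REAL-RANK-ONE valuation of the surface's function field or a
       transcendental formal arc (Zariski–Abhyankar), and the transversal coefficient ideal becomes an exceptional
       MONOMIAL on the surface (embedded curve resolution + (C1)); w = 3 ⇒ (by `GeneratorHugging`) a prime divisor
       `V(g) ∋ pt m` of generator size is hugged and the shadow sequence on the threefold `V(g)` hugs no proper germ
       (Shannon: rank-one valuation of `K(V(g))`).  Eternal components with `τ = 1` force `w = 2` (iterated cone lemma:
       the points proximate to `pt j` of order `n` lie on the strict transforms of the plane `ℙ(Dir_j) ⊂ E_j`).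
  The tree's bisection CONTACT 31571 / WILD 31572 of the hugging class is reached BY NAME from the leaves RESTRICTED to
  the residual (`NonMonomialContactTowersTerminate`, `NonMonomialWildTowersTerminate`; kernels
  `noContactHuggingTowers_of_pieces`, `noWildHuggingTowers_of_pieces`, converses `nonMonomialContact_of_contact`,
  `nonMonomialWild_of_wild`); it is orthogonal to (C3) (minimal eventual multiplicity `e = 1` vs `e ≥ 2` of the hugged
  prime divisors).

Upward kernels BY NAME (PROVED, 0 sorry): `noHuggingTowers_of_pieces` / `noHuggingTowers_of_leaves` /
`noHuggingTowers_iff_nonMonomial` (31570; THE ONE EQUIV), `noForcedTowers_of_pieces` / `noForcedTowers_of_leaves` /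
`noForcedTowers_iff_nonMonomial` (30253, same layer), `noContactHuggingTowers_of_pieces` (31571),
`noWildHuggingTowers_of_pieces` (31572), `noTransversalTowers_of_monomial` / `noTransversalTowers_of_cornerNormalFormAll`
(31569), `noCoreValuativeTowers_of_cornerNormalFormAll` (31573 → 31261), `noCoreGermHuggingTowers_of_pieces` (31260),
`noGrowingTowers_of_nonMonomial` (30257: a residually GROWING tower is non-monomial), `rungOne_of_pieces` /
`rungOne_of_located` (29273), `core_of_pieces` / `core_of_leaves` (28544), necessity `pieces_of_noForcedTowers`
(port-free) / `pieces_of_noHuggingTowers` (mod `TransversalMonomial`): every piece is a sub-class of the tower class,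
WEAKER-or-equal by construction.

PAPER PROOFS (ports = HYPOTHESES of kernels, counted 0).  Notation: `T` an infinite forced tower of the class
(marking `n ≥ 1`), `R_i := 𝒪_{St i, pt i}` (regular local UFD, `dim R_i =: d ≤ 4`, constant along the tower),
`I_i := (D i).ideal · R_i`; (a)–(f) are the steps of g9's (M1) re-walked by the critic (row 58; now the docstring of
`Theorems.MonomialTowerClasses`): (a) `ord_{pt i} I_i = n`; (b) the boundary at stage `i` = strict transforms of the own
exceptional components, snc, the `e_i` of them through `pt i` have equations `x_1, …, x_{e_i}` part of an r.s.p.;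
(c) a principal prime germ `(g) ∋ pt m` NOT hugged from stage `m` has its iterated strict factor a UNIT from some stage
on, so `g R_i = unit × exceptional monomial`; (d) hence if no prime factor of a finite generating set of `I_m` is hugged
from stage `m`, `I_i` is MONOMIAL in the boundary equations for `i ≫ 0` (controlled transform = `I_m R_i · ∏ (J_l
R_i)^{-n}`, monomial by unique factorisation); (e) a monomial `I_i` of order `n` with `pt i` isolated in the top locus
forces a FULL CORNER `e_i = d`; (f) then `pt (i+1)` is the origin of a standard chart `dir i`, `κ` is constant,
`G_{i+1} = chart_{dir i} G_i`; (g) = the exhaustive clause of the tree's `CornerNormalFormPlus` (aside 31573).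
(h) `GeneratorHugging`: fix `m`; `I_m` has a finite generating set of elements of order EXACTLY `n` (replace a
    generator `f'` of order `> n` by `f' + f`, `ord f = n`).  If NO prime factor `g` of a member of it were hugged from
    stage `m`, (c)(d) (based at `m`) make `T` eventually monomial.  So a never-monomial tower has, for every `m`, a
    prime `g ∣ f`, `f ∈ I_m`, `ord f = n`, with `V(g)` hugged from `m`: `H := ` the ideal sheaf of the prime divisor
    `closure V(g)` has stalk `(g)` (prime, principal), `f ∈ I_m ∩ (g)` so `idealOrder (I_m ⊓ H) = n`. ∎
    `TransversalMonomial` = (c)(d) (a hug-nothing tower hugs no prime factor of anything) and is ALSO the immediate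
    corollary of `GeneratorHugging` (`transversalMonomial_of_generatorHugging`, PROVED).
(i) `MonomialCorner` = (a)(b)(e)(f) applied from the stage `i₀` of `EventuallyMonomial` (no hugging hypothesis is
    used in (e)(f)); `d ≤ 4` from `IsBase.dim_le` (blow-ups preserve the dimension at closed points). ∎
(j) `CurveLaw`.  Let `HugsGerm T m H` with `dim R_m / H_m = 1`.  STEP 1: `V(strictIter m H j)` is the `j`-fold strict
    transform of the one-dimensional subscheme `V(H)` (saturated transform = schematic closure off the exceptional
    divisor, `strictTransformIdeal` = saturation [GortzWedhorn2020 (13.19)]), its irreducible components through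
    `pt (m+j)` are strict transforms of the finitely many irreducible components of `V(H)` through `pt m`, and
    membership is inherited downwards (`π` maps `C^{(j+1)}` to `C^{(j)}`); by pigeonhole ONE integral curve `C ∋ pt m`
    has `pt (m+j) ∈ C^{(j)}` for all `j`.  STEP 2: `C^{(j+1)} = Bl_{pt (m+j)} C^{(j)}` [Hartshorne1977 II.7.15]; `C` is
    an excellent reduced curve, and blowing up a singular closed point strictly decreases `δ = length(normalisation /
    local ring)`, so from some stage on `pt (m+j)` is a REGULAR point of `C^{(j)}`; re-base there.  STEP 3 (C regular at
    `pt m`): `R̂_m ≅ K[[x_1, …, x_{d-1}, t]]` (Cohen, `K = κ(pt m)`, equicharacteristic) with `C = V(x)`;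
    `ν := max {e : I_m R̂ ⊆ (x)^e} = ord_{η_C} I_m ≤ n − 1` because `C ⊄ supp (D m)` (`pt m` is ISOLATED in it and `C`
    is a curve through `pt m`); write `f = Σ_β f_β(t) x^β` and put
    `μ_0 := min {ord_t f_β : f ∈ I_m R̂, |β| = ν} ∈ ℕ`.
    LOWER BOUND: `I_m ⊆ 𝔪^n` and `𝔪̂^n` is the monomial ideal of all monomials of degree `≥ n`, so
    `ord_t f_β ≥ n − |β|`, i.e. `μ_0 ≥ n − ν =: δ ≥ 1`.  TRANSFORM: `pt (m+1)` is THE point of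
`C^{(1)}` over `pt m` =
    the origin of the `t`-chart, `R̂_{m+1} = K[[x', t]]`, `x = t x'`, `C^{(1)} = V(x')`, and `I_{m+1} R̂_{m+1} =
    t^{-n} I_m R̂_{m+1} ∋ f / t^n = Σ_β f_β(t) t^{|β| − n} x'^β` (controlled transform; completion commutes with the
    blow-up of the closed point); so `ν` is UNCHANGED and `μ_1 ≤ μ_0 − δ`.  All hypotheses persist ((a):
order `≥ n` at
    `pt (m+1)`; `C^{(1)}` regular and hugged; `ν`), so `δ ≤ μ_{j+1} ≤ μ_j − δ` for all `j` — the data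
`(δ, μ)` of the
    port; `noInfiniteDescent` ends it.  No use of `p`, perfectness or `d`. ∎
    (Classical twin: CossartJannsenSaito2020 Thm 6.35 / Cor. 6.37 [pdf p.104–105] — `x` isolated in the Hilbert–Samuel
    locus with `e_x = 1` ⇒ the fundamental sequence of point blow-ups at the near points is FINITE — proved in Ch. 10
    (Thm 10.2, p.138) by the `δ`-invariant of the characteristic polyhedron, i.e. by the same `t`-adic descent; the
    curve version is the statement «a curve through infinitely many successive `n`-fold points is equimultiple»,
    and `ν = n` contradicts isolation.  The SAME computation kills a tower following a FORMAL regular arc (work in `R̂_m`;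
    `ν < n` by isolation since order loci commute with completion) — such towers are eventually FREE, g8's leaf 31258.)
(k) `EternalBound`.  If own components `E_{j_1}, …, E_{j_r}` are hugged forever then for `i > max j_s + 1` the
    point `pt i` lies on their `r` strict transforms AND on `E_{i-1}`, `r + 1` distinct components of an snc divisor,
    so `r + 1 ≤ d`.  If `r = d − 1`: `C_i := ⋂_s E_{j_s}^{(i)} = V(x_1, …, x_{d-1})` is a REGULAR CURVE germ through
    `pt i`, the points over `pt i` on all `d − 1` strict transforms form the single point `C_i^{(1)} ∩ E_i` (origin of
    the `t`-chart), and `⋂_s E_{j_s}^{(i+1)} = C_i^{(1)}` near it; inductively `T` hugs `C_i` (`H := Σ_s 𝓘(E_{j_s}^{(i)})`,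
    stalk `(x_1, …, x_{d-1})`, `dim R_i/H = 1`) — excluded by (j).  Hence `r ≤ d − 2 ≤ 2`. ∎
STRUCTURE OF THE RESIDUAL (port-level remarks, not typed as ports): (w = 2) the hugged surface germ `S` may be taken
integral (STEP 1), its strict transforms `S_i ∋ pt i` are the blow-ups of `S` at the points; no curve of `S` is hugged
(C1), so by embedded resolution of curves on `S` every element of `𝒪_{S, pt m}` becomes exceptional-monomial × unit at
`pt i`, `i ≫ 0` ((c) one dimension down), and `⋃_i 𝒪_{S_i, pt i}` is the ring of a ZERO-DIMENSIONAL valuation `v` of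
`K(S)` centred at every `pt i` [KiyekVicente2004 VIII (4.6), p.526; Abhyankar1956]; `v` has rank one (a rank-two `v` is
composed with a prime divisor of `K(S)` whose centre on `S_i` is eventually a curve `C_i ∋ pt i` followed by the points
— excluded by (C1)) and is not discrete of rank one (that is a formal arc: eventually free, leaf 31258), so `v` is
IRRATIONAL (rational rank 2) or of PUISEUX type (rational rank 1, unbounded denominators) — satellite-recurrent, as the
tree's core leaves require; the degree-`ν_S` coefficient ideal of `I_i` along the regular locus of `S_i` transforms as
a controlled transform with marking `n − ν_S` (STEP 3 with two transversal variables) — but WITHOUT isolation on the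
shadow (critic caveat row 52; an irrational monomial valuation carries such a shadow with growing orders: dead end
recorded in NOTES, so (w = 2) is NOT decided by the curve-law mechanism); (w = 3) by (h) some prime divisor `X = V(g)`,
`g ∣ f ∈ I_m`, is hugged and the point sequence on the threefolds `X_i = Bl X_{i-1}` hugs no proper germ of `X`
(Shannon1973; HeinzerOlberdingToeniskoetter2017 Discussion 4.2: `⋃ 𝒪_{X_i, pt i}` is a rank-one valuation ring when
`X` is regular at the points, i.e. in the CONTACT sub-class `e = 1`); ETERNAL `τ = 1` components force `w = 2`: all
degree-`n` initial forms at `pt j` are `c · z^n`, the controlled transform restricted to `E_j ≅ ℙ^{d-1}` is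
`𝓘_{Π}^n`, `Π = {z = 0}`, and order `n` at the later points on `E_j^{(i)}` holds iff they lie on the strict transforms
of the regular `(d−2)`-dimensional germ `Π` (elementary for `τ = 1` and every `k`: `(f/t^n)|_{E_j} = in_n(f)|_{E_j} =
c_f · z^n`, and `𝓘_Π^n` has order `n` exactly on `Π`; iterate with the strict transforms of `E_j`; cf.
CossartJannsenSaito2020 Thm 3.14, p.51, near points lie on `ℙ(Dir)`); an eternal component with `τ_j = d − 1` is exited
at once (`(z_1, …, z_{d-1})^n|_{E_j}` has empty order-`n` locus after one point blow-up) and one with `2 ≤ τ_j ≤ d − 2`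
makes the tower hug the linear germ `ℙ(Dir_j) ⊂ E_j` of dimension `d − 1 − τ_j ≤ 1` — a curve, excluded
by (C1) — as
soon as `pt (j+1)` is `κ(pt j)`-rational (a degree-`n` form with a rational point of multiplicity `n` is a cone over it;
in general Giraud's ridge replaces the directrix, cf. the tree port `ConeLineLaw`): so on the residually STATIONARY
located class EVERY eternal component has `τ_j = 1` and forces `w = 2`, for every `k`.

Tags per piece are in the docstrings: COSTUME / WEAKER / UNDECIDED / DECIDED-MOD-PORT / KNOWN-MOD-PORT / ATTACKABLE /
IDEA-NEEDED / INSTRUMENTABLE.  Ports are HYPOTHESES of kernels, counted 0.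
[BierstoneGrigorievMilmanWlodarczyk2011 §3; GortzWedhorn2020 (13.19); Hartshorne1977 II.7; Blanco arXiv:0902.2887;
Shannon1973; HeinzerOlberdingToeniskoetter2017; HLOST arXiv:1505.06445; Abhyankar1956; KiyekVicente2004;
Zariski1944; CossartJannsenSaito2020; Kollar2007]
-/


set_option autoImplicit false

open CategoryTheory AlgebraicGeometry
open Literature.AlgebraicGeometry.Resolution
open Summit.ResolutionOfSingularities.ResolutionOfSingularities.Theorems
open WeakOrderReduction ForcedTowerClasses DivergentTowerClasses MonomialTowerClasses

namespace Summit.ResolutionOfSingularities.ResolutionOfSingularities.Theorems.HugDimensionClasses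

/-! ## §1 Elementary kernels (the corner-tower calculus `Expo` / `CornerTower` / `NoCornerTower` /
`CornerTower.not_exhaustive` is the TREE's `Theorems.MonomialTowerClasses`, imported) -/

/-- All corner towers in at most four parameters terminate (the `∀ n ≥ 1` shape the scheme side consumes; KNOWN-MOD-PORT
via the tree's `CornerModel` + `TowerObstructs`, ATTACKABLE directly = cheap theorem #17′). -/
def NoCornerTowers : Prop := ∀ n : ℕ, 1 ≤ n → ∀ d : ℕ, d ≤ 4 → NoCornerTower d n


/-- A strictly descending `ℕ`-valued invariant bounded below does not exist (the Lean half of the CURVE LAW).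
[folklore] -/
theorem noInfiniteDescent {δ : ℕ} {μ : ℕ → ℕ} (hδ : 1 ≤ δ) (hlow : ∀ j, δ ≤ μ j)
    (hstep : ∀ j, μ (j + 1) + δ ≤ μ j) : False := by
  have key : ∀ j, μ j + j * δ ≤ μ 0 := by
    intro j
    induction j with
    | zero => simp
    | succ j ih =>
      have := hstep j
      rw [add_mul, one_mul]
      omega
  have h1 := key (μ 0 + 1)
  have h2 : μ 0 + 1 ≤ (μ 0 + 1) * δ := Nat.le_mul_of_pos_right _ hδ
  have h3 := hlow (μ 0 + 1)
  omega

/-! ## §2 Predicates on the tree's `ForcedTower` (the tree's `HugsGerm` / `GermHugging` / `ContactHugging` / `Hugs`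
/ `NoTower` imported) -/

/-- The controlled transform is MONOMIAL IN THE BOUNDARY at stage `i`: the stalk of `(D i).ideal` at `pt i` is generated
by finitely many products of powers of the stalks of the boundary components (components not through `pt i` have unit
stalk and do not matter). Intrinsic — no chart, no hugging hypothesis. -/
def MonomialAt (T : ForcedTower) (i : ℕ) : Prop :=
  ∃ G : Finset (Fin (T.D i).boundary.length → ℕ),
    stalkIdeal (T.D i).ideal (T.pt i) =
      ⨆ α ∈ G, ∏ l, stalkIdeal ((T.D i).boundary.get l) (T.pt i) ^ α l

/-- EVENTUALLY MONOMIAL tower (persistent once true, port-level). -/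
def EventuallyMonomial (T : ForcedTower) : Prop :=
  ∃ i₀ : ℕ, ∀ i, i₀ ≤ i → MonomialAt T i

/-- The tower hugs forever a germ `V(H) ∋ pt m` whose local ring `𝒪_{St m, pt m} / H` has Krull dimension `w`. -/
def HugsGermOfDim (T : ForcedTower) (w : ℕ) : Prop :=
  ∃ (m : ℕ) (H : (T.St m).IdealSheafData), HugsGerm T m H ∧
    ringKrullDim ((T.St m).presheaf.stalk (T.pt m) ⧸ stalkIdeal H (T.pt m)) = (w : WithBot ℕ∞)

/-- CURVE HUGGING: a one-dimensional germ is hugged forever (`w = 1`). -/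
def CurveHugging (T : ForcedTower) : Prop := HugsGermOfDim T 1

/-- SURFACE HUGGING: a two-dimensional germ is hugged forever (`w = 2`; in a fourfold: codimension 2). -/
def SurfaceHugging (T : ForcedTower) : Prop := HugsGermOfDim T 2

/-- THREE ETERNAL COMPONENTS: three distinct own exceptional components are hugged forever. -/
def ThreeEternal (T : ForcedTower) : Prop :=
  ∃ j₁ j₂ j₃ : ℕ, j₁ ≠ j₂ ∧ j₁ ≠ j₃ ∧ j₂ ≠ j₃ ∧ Hugs T j₁ ∧ Hugs T j₂ ∧ Hugs T j₃

/-- GENERATOR HUGGED (structure of the residual): from EVERY stage `m` a PRIME DIVISOR of generator size is hugged —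
some `H` with prime principal stalk `(g)` at `pt m`, hugged forever, and `I_m ⊓ H` of order exactly `n` at `pt m`
(`g` divides a member of `I_m` of order `n`). -/
def GeneratorHugged (T : ForcedTower) (n : ℕ) : Prop :=
  ∀ m : ℕ, ∃ H : (T.St m).IdealSheafData, HugsGerm T m H ∧
    (stalkIdeal H (T.pt m)).IsPrime ∧ (stalkIdeal H (T.pt m)).IsPrincipal ∧
      idealOrder ((T.D m).ideal ⊓ H) (T.pt m) = (n : ℕ∞)

/-- A tower hugging a germ of some dimension hugs a germ. [folklore] -/
theorem germHugging_of_hugsGermOfDim {T : ForcedTower} {w : ℕ} (h : HugsGermOfDim T w) : GermHugging T := by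
  obtain ⟨m, H, hH, -⟩ := h
  exact ⟨m, H, hH⟩

/-- A generator-hugged tower hugs a germ (take stage `0`). [folklore] -/
theorem germHugging_of_generatorHugged {T : ForcedTower} {n : ℕ} (h : GeneratorHugged T n) : GermHugging T := by
  obtain ⟨H, hH, -⟩ := h 0
  exact ⟨0, H, hH⟩

/-! ## §3 Tower classes (pieces) and their EXACT calculus -/

/-! The g9 pieces `TransversalTowersTerminate n` (DECIDED-MOD-PORT, tree) and `HuggingTowersTerminate n` (g9's located
residual, tree; asides 31569 / 31570) are IMPORTED. -/

/-- PIECE · DECIDED-MOD-PORT(KNOWN) (`monomial_of_ports`: `MonomialCorner` + `NoCornerTower d n, d ≤ 4`): no infinite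
EVENTUALLY MONOMIAL forced tower (contains every transversal and every boundary-hugging monomial tower). -/
def MonomialTowersTerminate (n : ℕ) : Prop := NoTower n EventuallyMonomial

/-- PIECE · THE LOCATED RESIDUAL of the tower side after g10 (UNDECIDED, score 0): no infinite NEVER-MONOMIAL forced
tower (by `GeneratorHugging` such a tower hugs a prime divisor of generator size from every stage). -/
def NonMonomialTowersTerminate (n : ℕ) : Prop := NoTower n fun T => ¬ EventuallyMonomial T

/-- PIECE · DECIDED-MOD-PORT for ALL `k` (`curve_of_curveLaw`, port `CurveLaw` = classical transversal-order drop):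
no infinite forced tower hugs a ONE-DIMENSIONAL germ. -/
def CurveHuggingTowersTerminate (n : ℕ) : Prop := NoTower n CurveHugging

/-- LEAF of the residual (w = 2) · UNDECIDED · ATTACKABLE(partial normal form: the shadow on the hugged surface is the
centre sequence of a real-rank-one valuation / formal arc and the transversal coefficient ideal becomes an exceptional
monomial there) · IDEA-NEEDED for the kill (no isolation on the shadow) · INSTRUMENTABLE (T-hug-dim): no infinite
never-monomial tower hugging a SURFACE germ but no curve. -/
def SurfaceHuggingTowersTerminate (n : ℕ) : Prop :=
  NoTower n fun T => ¬ EventuallyMonomial T ∧ ¬ CurveHugging T ∧ SurfaceHugging T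

/-- LEAF of the residual (w = 3) · UNDECIDED · IDEA-NEEDED (Shannon rank-one valuation on the hugged prime divisor of
generator size; the Moh / defect habitat if anywhere): no infinite never-monomial tower hugging ONLY germs of dimension
`≥ 3` (no curve, no surface). -/
def HypersurfaceHuggingTowersTerminate (n : ℕ) : Prop :=
  NoTower n fun T => ¬ EventuallyMonomial T ∧ ¬ CurveHugging T ∧ ¬ SurfaceHugging T

/-- SECONDARY LEAF = the tree's CONTACT leaf 31571 RESTRICTED to the residual (orthogonal to the `w`-cut: minimal
eventual multiplicity `e = 1`) · UNDECIDED · ATTACKABLE (dim-3 shadow, caveat row 52): NEVER-MONOMIAL towers of PERMANENT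
CONTACT with a regular hypersurface germ (the boundary-hugging monomial towers of 31571 are peeled off as decided). -/
def NonMonomialContactTowersTerminate (n : ℕ) : Prop :=
  NoTower n fun T => ¬ EventuallyMonomial T ∧ ContactHugging T

/-- SECONDARY LEAF = the tree's WILD leaf 31572 restricted to the residual (`e ≥ 2`) · UNDECIDED · IDEA-NEEDED:
never-monomial towers hugging NO regular hypersurface germ. -/
def NonMonomialWildTowersTerminate (n : ℕ) : Prop :=
  NoTower n fun T => ¬ EventuallyMonomial T ∧ ¬ ContactHugging T

/-- Kernel (PROVED): **EXACT `ForcedTowersTerminate n ⟺ Monomial ∧ NonMonomial`.** [folklore] -/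
theorem ftt_iff_monomial_nonMonomial {n : ℕ} :
    ForcedTowersTerminate n ↔ MonomialTowersTerminate n ∧ NonMonomialTowersTerminate n := by
  rw [forcedTowersTerminate_iff_noTower, noTower_split (fun _ => True) EventuallyMonomial]
  exact and_congr ⟨noTower_mono fun _ h => ⟨trivial, h⟩, noTower_mono fun _ h => h.2⟩
    ⟨noTower_mono fun _ h => ⟨trivial, h⟩, noTower_mono fun _ h => h.2⟩

/-! (The EXACT g9 cut `ForcedTowersTerminate n ⟺ Transversal ∧ Hugging` is the tree's
`forcedTowersTerminate_iff_transversal_hugging`.) -/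

/-- Kernel (PROVED): **EXACT cut of the residual by the minimal hugged dimension `w`:
`NonMonomial ⟺ (∧ CurveHugging) ∧ SurfaceHugging-leaf ∧ Hypersurface-leaf`.** [folklore] -/
theorem nonMonomial_iff_leaves {n : ℕ} :
    NonMonomialTowersTerminate n ↔
      NoTower n (fun T => ¬ EventuallyMonomial T ∧ CurveHugging T) ∧
        SurfaceHuggingTowersTerminate n ∧ HypersurfaceHuggingTowersTerminate n := by
  unfold NonMonomialTowersTerminate SurfaceHuggingTowersTerminate HypersurfaceHuggingTowersTerminate
  rw [noTower_split (fun T => ¬ EventuallyMonomial T) CurveHugging,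
    noTower_split (fun T => ¬ EventuallyMonomial T ∧ ¬ CurveHugging T) SurfaceHugging]
  simp only [and_assoc]

/-- The curve piece in its natural (un-intersected) form suffices. [folklore] -/
theorem nonMonomial_of_leaves {n : ℕ} (hC : CurveHuggingTowersTerminate n) (hS : SurfaceHuggingTowersTerminate n)
    (hH : HypersurfaceHuggingTowersTerminate n) : NonMonomialTowersTerminate n :=
  nonMonomial_iff_leaves.mpr ⟨noTower_mono (fun _ h => h.2) hC, hS, hH⟩

/-- Kernel (PROVED): **EXACT secondary cut `NonMonomial ⟺ restricted Contact-leaf ∧ restricted Wild-leaf`.** [folklore] -/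
theorem nonMonomial_iff_contact_wild {n : ℕ} :
    NonMonomialTowersTerminate n ↔ NonMonomialContactTowersTerminate n ∧ NonMonomialWildTowersTerminate n := by
  unfold NonMonomialTowersTerminate NonMonomialContactTowersTerminate NonMonomialWildTowersTerminate
  rw [noTower_split (fun T => ¬ EventuallyMonomial T) ContactHugging]

/-- Necessity, port-free: every piece is implied by the tower piece (WEAKER-or-equal by construction). [folklore] -/
theorem allPieces_of_ftt {n : ℕ} (h : ForcedTowersTerminate n) :
    TransversalTowersTerminate n ∧ HuggingTowersTerminate n ∧ MonomialTowersTerminate n ∧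
      NonMonomialTowersTerminate n ∧ CurveHuggingTowersTerminate n := by
  have h' := forcedTowersTerminate_iff_noTower.mp h
  exact ⟨noTower_mono (fun _ _ => trivial) h', noTower_mono (fun _ _ => trivial) h',
    noTower_mono (fun _ _ => trivial) h', noTower_mono (fun _ _ => trivial) h', noTower_mono (fun _ _ => trivial) h'⟩

/-- Necessity of the leaves, port-free. [folklore] -/
theorem leaves_of_ftt {n : ℕ} (h : ForcedTowersTerminate n) :
    SurfaceHuggingTowersTerminate n ∧ HypersurfaceHuggingTowersTerminate n ∧ NonMonomialContactTowersTerminate n ∧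
      NonMonomialWildTowersTerminate n := by
  have h' := forcedTowersTerminate_iff_noTower.mp h
  exact ⟨noTower_mono (fun _ _ => trivial) h', noTower_mono (fun _ _ => trivial) h',
    noTower_mono (fun _ _ => trivial) h', noTower_mono (fun _ _ => trivial) h'⟩


/-! ## §4 Ports (HYPOTHESES of kernels, counted 0; paper proofs in the module docstring) -/

/-! The g9 ports `CornerNormalForm n` (M1), `CornerNormalFormPlus n` (M1⁺, aside `CornerNormalFormAll` 31573) and
`CornerModel n` are the TREE's (imported). -/

/-- PORT `TransversalMonomial` — (c)(d): a tower hugging no germ is eventually monomial (implied by `GeneratorHugging`,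
kernel `transversalMonomial_of_generatorHugging`). -/
def TransversalMonomial (n : ℕ) : Prop :=
  ∀ p : ℕ, p.Prime → ∀ (k : Type) [Field k] [CharP k p] (T : ForcedTower) (g : T.St 0 ⟶ Spec (.of k)),
    IsBase (T.St 0) g → IsDatum n (T.D 0) → (T.D 0).boundary = [] → ¬ GermHugging T → EventuallyMonomial T

/-- PORT `MonomialCorner` — (a)(b)(e)(f) = (i): an eventually monomial tower is residually eventually STATIONARY and
carries a corner tower in `d ≤ 4` parameters (isolation forces a full corner, the next point is a chart origin).
COSTUME-level bookkeeping, all `k`. -/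
def MonomialCorner (n : ℕ) : Prop :=
  ∀ p : ℕ, p.Prime → ∀ (k : Type) [Field k] [CharP k p] (T : ForcedTower) (g : T.St 0 ⟶ Spec (.of k)),
    IsBase (T.St 0) g → IsDatum n (T.D 0) → (T.D 0).boundary = [] → EventuallyMonomial T →
      T.EventuallyStationary ∧ ∃ d : ℕ, d ≤ 4 ∧ Nonempty (CornerTower d n)

/-- PORT `GeneratorHugging` — STRUCTURE of the residual, paper proof (h) (contrapositive of (c)(d) at every stage):
a never-monomial tower is `GeneratorHugged`. NEW LEMMA, elementary, all `k`. -/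
def GeneratorHugging (n : ℕ) : Prop :=
  ∀ p : ℕ, p.Prime → ∀ (k : Type) [Field k] [CharP k p] (T : ForcedTower) (g : T.St 0 ⟶ Spec (.of k)),
    IsBase (T.St 0) g → IsDatum n (T.D 0) → (T.D 0).boundary = [] → ¬ EventuallyMonomial T → GeneratorHugged T n

/-- PORT `CurveLaw` — KNOWN/elementary (paper proof (j), all `k`, `p`, `d`): along a hugged curve the port delivers the
DESCENDING TRANSVERSAL INVARIANT `(δ = n − ν ≥ 1, μ_j)` with `δ ≤ μ_j` and `μ_{j+1} + δ ≤ μ_j`; Lean ends it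
(`noInfiniteDescent`). -/
def CurveLaw (n : ℕ) : Prop :=
  ∀ p : ℕ, p.Prime → ∀ (k : Type) [Field k] [CharP k p] (T : ForcedTower) (g : T.St 0 ⟶ Spec (.of k)),
    IsBase (T.St 0) g → IsDatum n (T.D 0) → (T.D 0).boundary = [] → CurveHugging T →
      ∃ (δ : ℕ) (μ : ℕ → ℕ), 1 ≤ δ ∧ (∀ j, δ ≤ μ j) ∧ ∀ j, μ (j + 1) + δ ≤ μ j

/-- PORT `EternalBound` — paper proof (k) (snc + the curve law): at most `d − 2 ≤ 2` own components are ETERNAL. -/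
def EternalBound (n : ℕ) : Prop :=
  ∀ p : ℕ, p.Prime → ∀ (k : Type) [Field k] [CharP k p] (T : ForcedTower) (g : T.St 0 ⟶ Spec (.of k)),
    IsBase (T.St 0) g → IsDatum n (T.D 0) → (T.D 0).boundary = [] →
      ∀ j₁ j₂ j₃ : ℕ, Hugs T j₁ → Hugs T j₂ → Hugs T j₃ → j₁ = j₂ ∨ j₁ = j₃ ∨ j₂ = j₃


end Summit.ResolutionOfSingularities.ResolutionOfSingularities.Theorems.HugDimensionClasses
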